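import Summits.QuantumFields.BalabanUV.T4Continuum.Spine.NE3.QbarTowerB8
import Summits.QuantumFields.BalabanUV.T4Continuum.Spine.NE3.PairFrameCondition
import HarnessLib

/-!
# T⁴ programme, node NE3 — census R51 (first brick): THE NORMAL DATUM `QbarIter Z` OF A REPRESENTATIVE WITHOUT (1.37) — `Ad(QbarIter Z) = log U̿′ᵏ − (Prop-4 remainder)`,
# hence `‖QbarIter Z‖ ≤ q + 8C₁e^{4cα₀}(L^k·sup‖Z‖)²` under a DOUBLE-BAR BUDGET `‖log U̿′ᵏ‖ ≤ q`; and at the pair `U̿′ᵏ = V^{g⁻¹}·V⁻¹` (`QbarTowerB8Budget`)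

Cell `pub-balaban-gaps` (track G2, seat ne3, generation 11), row NE3; census `HOME/ne/NE3.md` §4 R51, §17.  THE END's chart supplier consumes the (1.37) clause `LandauRepB8Avg.dbar`
(`dbavgCovIter L W (relPert W Z) k = 1`) at exactly ONE place: `QbarTowerB8.norm_QbarIter_le` ∕ `CoarseSizesFromTowersB8.coarseSizes_of_towers` (binder `hdbar`), to make the
k-fold linearised double-bar average `QbarIter L k W Z` of B8's direction QUADRATIC in its sup size (the «coarse sizes» of the normal part).  This module records the
dbar-FREE form of that step — the located weakening behind census door R51 («THE END needs (1.37) only up to a quadratic budget»):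

* §1 `adField_QbarIter_eq_mlog_sub_remainder` — with NO hypothesis on the k-th double-bar average: `Ad_{W̄ᵏ}(QbarIter L k W Z) = log U̿′ᵏ − (logCovIter − linCovIter)ₖ`
  (`QbarTowerB8.linCovIter_adField` + `logCovIter_succ_eq_mlog_dbavgCovIter`; [Balaban1985Averaging] (120)∕(127), Prop. 4); `norm_adField_QbarIter_le_of_budget`,
  **`norm_QbarIter_le_of_budget`** — in the regime of `B7Eq123General.prop4_general` (the hypotheses of `QbarTowerB8.norm_QbarIter_le` with `hdbar` REPLACED by a budget
  `‖log U̿′ᵏ(c)‖ ≤ q`): `‖QbarIter L k W Z (c)‖ ≤ q + 8·131072(d+1)²·e^{3200(d+1)²(d+4)α₀}·(L^k·b)²`.  At `q = 0` this is the tree's `norm_QbarIter_le`.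
* §2 `dbavgCovIter_eq_of_rep_pair` — at a pair with common average `V` and `U_A^{u} = W·e^{Z}`: `U̿′ᵏ(c) = (V^{g⁻¹})(c)·V(c)⁻¹` with the coarse frame gauge `g = u_k⁻¹·v_k(U′)` of
  `PairFrameCondition.avgIter_eq_of_rep` — so the budget `q` measures HOW FAR `g` IS FROM STABILISING THE DATUM, and (1.37) (`q = 0`) is the case `V^{g} = V` (census R49).

HONEST FRAMING (page 1).  Identities and one inequality about OUR typed objects (0 def, 0 sorry), over landed theorems BY NAME; nothing of Bałaban's is asserted or discharged; the
re-run of THE END on a budget `q > 0` (door R51) is NOT done here; `PairLandauGaugeB8Avg`, the covariant root and **NE3 are NOT proved**; spine PROVED 0∕9; finite T⁴ rung (B)+1 —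
NOT continuum YM on ℝ⁴, NOT infinite volume, NOT mass gap, NOT `BetaPertH`, NOT Clay.  HONEST DEPENDENCY: continuum YM on T⁴ ⇐ BetaPertH ∧ nine spine estimates (0/9 proved);
BetaPertH ⇐ (D1) ∧ (D4) ∧ CAP+tail; G-an2-4 gates asym, D1 and NE2/3/4.  PLACEMENT: `Summits/QuantumFields/BalabanUV/T4Continuum/Spine/NE3/`; imports the accepted `QbarTowerB8`
and `PairFrameCondition` only.
-/

set_option autoImplicit false

open scoped BigOperators Matrix Matrix.Norms.L2Operator
open NormedSpace Finset

namespace Summit.QuantumFields.BalabanUV.T4Continuum.NE3.QbarTowerB8Budget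

open Literature.MathematicalPhysics.QuantumFieldTheory.Balaban1983to89
open B7Prop1Explicit B7Prop2Explicit B7Prop3Flat MatrixLog
open T4AveragingDeficitWall (Ad IsUnitaryCfg vary)
open AveragingDeficitTransport (norm_Ad_of_unitary)
open AveragingDeficitChartCalculus (cavg)
open AveragingDeficitMultiLevelPrep (cavgIter)
open AveragingDeficitMultiLevelBridge (cavgIter_eq_avgIter)
open NE3TangentCovariantTower (QbarIter)
open B7AvgGaugeCovariance (uLev)
open B7Eq92Concrete (vcov dbavgCovIter)
open B7Prop4GeneralLevels (logCovIter linCovIter)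
open B7Eq123General (prop4_general level_data blockLoops_of_pdev)
open NE3.PairLandauB8Avg (relPert)
open NE3.QbarDictionary (adField relPert_eq_expCfg_adField)
open NE3.QbarTowerB8 (logCovIter_succ_eq_mlog_dbavgCovIter linCovIter_adField)
open NE3.PairFrameCondition (avgIter_eq_of_rep gaugeAct_inv_gaugeAct)

noncomputable section

variable {d : ℕ} {n : Type*} [Fintype n] [DecidableEq n]

/-! ## §1 The Π-C identity WITHOUT (1.37), and the budget form of the coarse sizes -/

/-- **THE Π-C IDENTITY WITHOUT (1.37)**: if the `j`-th double-bar average of `e^{A}`, `A = Ad_W Z`, is the exponential of the `j`-th composite and every averaged background has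
one-block loops within `1` of the identity, then `Ad_{W̄^{j+1}}(QbarIter L (j+1) W Z)(c) = log U̿′^{j+1}(c) − (logCovIter − linCovIter)_{j+1}(c)` — `QbarTowerB8.adField_QbarIter_eq_neg_remainder`
with its `hdbar` binder dropped and the double-bar logarithm kept on the right. [folklore] -/
theorem adField_QbarIter_eq_mlog_sub_remainder [Nonempty n] (L : ℕ) (W : Site d → Fin d → (Matrix n n ℂ)ˣ) (Z : Site d → Fin d → Matrix n n ℂ)
    (j : ℕ) (hj : dbavgCovIter L W (expCfg (adField W Z)) j = expCfg (logCovIter L W (adField W Z) j))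
    (hW : ∀ i < j + 1, ∀ (z : Site d) (κ : Fin d) (r : Fin d → Fin L),
      ‖((Wcx L (cavgIter L i W) ((L : ℤ) • z) κ (boxVec L r) : (Matrix n n ℂ)ˣ) : Matrix n n ℂ) - 1‖ < 1) (z : Site d) (κ : Fin d) :
    adField (cavgIter L (j + 1) W) (QbarIter L (j + 1) W Z) z κ
      = mlog ((dbavgCovIter L W (expCfg (adField W Z)) (j + 1) z κ : (Matrix n n ℂ)ˣ) : Matrix n n ℂ)
          - (logCovIter L W (adField W Z) (j + 1) - linCovIter L W (adField W Z) (j + 1)) z κ := by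
  rw [← linCovIter_adField L W Z (j + 1) hW, ← logCovIter_succ_eq_mlog_dbavgCovIter L W (adField W Z) j hj]
  simp only [Pi.sub_apply]
  abel

/-- **THE COARSE SIZE UNDER A DOUBLE-BAR BUDGET, START FRAME** (unitary background `W`, `L ≥ 2`; the regime of `B7Eq123General.prop4_general` exactly as in
`QbarTowerB8.norm_adField_QbarIter_le`, with `hdbar` replaced by `hq : ‖log U̿′^{j+1}(c)‖ ≤ q`):
`‖Ad_{W̄^{j+1}}(QbarIter L (j+1) W Z)(c)‖ ≤ q + 8·131072(d+1)²·e^{4·800(d+1)²(d+4)α₀}·(L^{j+1}·b)²`. [folklore] -/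
theorem norm_adField_QbarIter_le_of_budget [Nonempty n] (L : ℕ) (hL : 2 ≤ L) (W : Site d → Fin d → (Matrix n n ℂ)ˣ) (hWu : IsUnitaryCfg W)
    (Z : Site d → Fin d → Matrix n n ℂ) (j : ℕ) {α₀ b q : ℝ} (hα : 0 < α₀) (hα3 : C0 d * α₀ ≤ 1 / 3) (hα4 : 4 * α₀ ≤ c2' d L)
    (h52 : pdev W < α₀ * (((L : ℝ) ^ (j + 1))⁻¹) ^ 2) (hb : 0 ≤ b) (hZ : ∀ (x : Site d) (κ : Fin d), ‖Z x κ‖ ≤ b)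
    (hsmall : Real.exp (4 * (800 * ((d : ℝ) + 1) ^ 2 * ((d : ℝ) + 4)) * α₀)
      * (1 + 8 * (131072 * ((d : ℝ) + 1) ^ 2) * ((L : ℝ) ^ (j + 1) * b)) ≤ 2)
    (hc₃ : 2 * ((L : ℝ) ^ (j + 1) * b) ≤ c3 d L)
    (hq : ∀ (z : Site d) (κ : Fin d), ‖mlog ((dbavgCovIter L W (expCfg (adField W Z)) (j + 1) z κ : (Matrix n n ℂ)ˣ) : Matrix n n ℂ)‖ ≤ q) :
    ∀ (z : Site d) (κ : Fin d), ‖adField (cavgIter L (j + 1) W) (QbarIter L (j + 1) W Z) z κ‖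
      ≤ q + 8 * (131072 * ((d : ℝ) + 1) ^ 2) * Real.exp (4 * (800 * ((d : ℝ) + 1) ^ 2 * ((d : ℝ) + 4)) * α₀)
          * ((L : ℝ) ^ (j + 1) * b) ^ 2 := by
  letI : CStarAlgebra (Matrix n n ℂ) := {}
  have hG := avgClosed_unitaryUnits d (𝔸 := Matrix n n ℂ) L
  have hU₀ : ∀ (x : Site d) (κ : Fin d), W x κ ∈ unitaryUnits (Matrix n n ℂ) := hWu
  have hB : ∀ (x : Site d) (κ : Fin d), ‖adField W Z x κ‖ ≤ b := fun x κ => by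
    unfold adField
    rw [norm_Ad_of_unitary (hWu x κ)]
    exact hZ x κ
  have h4 := prop4_general L hL hG (j + 1) W hU₀ hα hα3 hα4 h52 (adField W Z) hb hB hsmall hc₃
  have hQ := B7Eq123General.dbavgCovIter_eq_expCfg_logCovIter L hL hG (j + 1) W hU₀ hα hα3 hα4 h52 (adField W Z) hb hB hsmall hc₃
  have hld := level_data L hL hG (j + 1) W hU₀ hα hα3 hα4 h52
  have hL1 : 1 ≤ L := by omega
  have hW : ∀ i < j + 1, ∀ (z : Site d) (κ : Fin d) (r : Fin d → Fin L),
      ‖((Wcx L (cavgIter L i W) ((L : ℤ) • z) κ (boxVec L r) : (Matrix n n ℂ)ˣ) : Matrix n n ℂ) - 1‖ < 1 := by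
    intro i hi z κ r
    obtain ⟨hV, hβ0, hβ, hβmax⟩ := hld i hi.le
    rw [cavgIter_eq_avgIter]
    have h := blockLoops_of_pdev hL1 hV hβ0 hβ hβmax ((L : ℤ) • z) κ
    exact ((h.1 r).trans h.2).trans_lt (by norm_num)
  intro z κ
  have hb4 := (h4 (j + 1) le_rfl).1 z κ
  rw [adField_QbarIter_eq_mlog_sub_remainder L W Z j (hQ j (Nat.le_succ j)) hW z κ]
  exact (norm_sub_le _ _).trans (add_le_add (hq z κ) hb4)

/-- **THE COARSE SIZE UNDER A DOUBLE-BAR BUDGET** for `QbarIter` itself, when the level-`(j+1)` averaged background is unitary: `‖QbarIter L (j+1) W Z (c)‖ ≤ q + (remainder)`.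
At `q = 0` (i.e. (1.37)) this is `QbarTowerB8.norm_QbarIter_le`. [folklore] -/
theorem norm_QbarIter_le_of_budget [Nonempty n] (L : ℕ) (hL : 2 ≤ L) (W : Site d → Fin d → (Matrix n n ℂ)ˣ) (hWu : IsUnitaryCfg W)
    (hWk : ∀ (j : ℕ), IsUnitaryCfg (cavgIter L j W))
    (Z : Site d → Fin d → Matrix n n ℂ) (j : ℕ) {α₀ b q : ℝ} (hα : 0 < α₀) (hα3 : C0 d * α₀ ≤ 1 / 3) (hα4 : 4 * α₀ ≤ c2' d L)
    (h52 : pdev W < α₀ * (((L : ℝ) ^ (j + 1))⁻¹) ^ 2) (hb : 0 ≤ b) (hZ : ∀ (x : Site d) (κ : Fin d), ‖Z x κ‖ ≤ b)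
    (hsmall : Real.exp (4 * (800 * ((d : ℝ) + 1) ^ 2 * ((d : ℝ) + 4)) * α₀)
      * (1 + 8 * (131072 * ((d : ℝ) + 1) ^ 2) * ((L : ℝ) ^ (j + 1) * b)) ≤ 2)
    (hc₃ : 2 * ((L : ℝ) ^ (j + 1) * b) ≤ c3 d L)
    (hq : ∀ (z : Site d) (κ : Fin d), ‖mlog ((dbavgCovIter L W (expCfg (adField W Z)) (j + 1) z κ : (Matrix n n ℂ)ˣ) : Matrix n n ℂ)‖ ≤ q) :
    ∀ (z : Site d) (κ : Fin d), ‖QbarIter L (j + 1) W Z z κ‖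
      ≤ q + 8 * (131072 * ((d : ℝ) + 1) ^ 2) * Real.exp (4 * (800 * ((d : ℝ) + 1) ^ 2 * ((d : ℝ) + 4)) * α₀)
          * ((L : ℝ) ^ (j + 1) * b) ^ 2 := by
  intro z κ
  have h := norm_adField_QbarIter_le_of_budget L hL W hWu Z j hα hα3 hα4 h52 hb hZ hsmall hc₃ hq z κ
  unfold adField at h
  rwa [norm_Ad_of_unitary (hWk (j + 1) z κ)] at h

/-! ## §2 At the pair: the double-bar average is the defect of the coarse frame gauge on the datum -/

/-- **THE DOUBLE-BAR AVERAGE OF THE REPRESENTATIVE AT A PAIR WITH COMMON AVERAGE `V`**: if `U_A^{u} = W·e^{Z}`, `Ū_Aᵏ = V = W̄ᵏ`, then with `U′ = relPert W Z` and the coarse frame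
gauge `g = u_k⁻¹·v_k(U′)` of `PairFrameCondition.avgIter_eq_of_rep`:  `U̿′ᵏ · V = V^{g⁻¹}`, i.e. bondwise `U̿′ᵏ(c) = (V^{g⁻¹})(c)·V(c)⁻¹` — the budget `‖log U̿′ᵏ‖` of §1 is the
displacement of the datum under `g⁻¹` ([Balaban1985Averaging] (159) ∘ (11)). [folklore] -/
theorem dbavgCovIter_mul_eq_of_rep_pair (L k : ℕ) {u : Site d → (Matrix n n ℂ)ˣ} {UA W V : Site d → Fin d → (Matrix n n ℂ)ˣ}
    {Z : Site d → Fin d → Matrix n n ℂ} (hrep : gaugeAct u UA = vary W Z 1) (hA : avgIter L UA k = V) (hW : avgIter L W k = V) :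
    dbavgCovIter L W (relPert W Z) k * V = gaugeAct (uLev L u⁻¹ k * vcov L W (relPert W Z) k)⁻¹ V := by
  have h := avgIter_eq_of_rep L k hrep
  rw [hA, hW] at h
  have h2 := congrArg (gaugeAct (uLev L u⁻¹ k * vcov L W (relPert W Z) k)⁻¹) h
  rwa [gaugeAct_inv_gaugeAct, eq_comm] at h2

/-- The same, bondwise and solved: `U̿′ᵏ(c) = (V^{g⁻¹})(c) · V(c)⁻¹`. [folklore] -/
theorem dbavgCovIter_eq_of_rep_pair (L k : ℕ) {u : Site d → (Matrix n n ℂ)ˣ} {UA W V : Site d → Fin d → (Matrix n n ℂ)ˣ}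
    {Z : Site d → Fin d → Matrix n n ℂ} (hrep : gaugeAct u UA = vary W Z 1) (hA : avgIter L UA k = V) (hW : avgIter L W k = V)
    (z : Site d) (κ : Fin d) :
    dbavgCovIter L W (relPert W Z) k z κ
      = gaugeAct (uLev L u⁻¹ k * vcov L W (relPert W Z) k)⁻¹ V z κ * (V z κ)⁻¹ := by
  have h := congrFun (congrFun (dbavgCovIter_mul_eq_of_rep_pair L k hrep hA hW) z) κ
  rw [Pi.mul_apply, Pi.mul_apply] at h
  rw [← h, mul_inv_cancel_right]

end

end Summit.QuantumFields.BalabanUV.T4Continuum.NE3.QbarTowerB8Budget
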